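import Mathlib
import Literature.MathematicalPhysics.QuantumFieldTheory.Balaban1983to89.B6Prop23DomainInput

/-!
# `Balaban1983to89.B6Prop23KernelInput` — (2.67)₁ ⇒ (2.68), p. 235: the kernel inputs `hX`, `hXw` of the assembled
Proposition 2.3 DERIVED from the block majorant of G′ (resp. G′(□̃)), and Proposition 2.3 re-assembled from the
random-walk majorants (`prop23_assembled_rw`)

B6 = T. Bałaban, *Propagators and renormalization transformations for lattice gauge theories. II*, Commun. Math. Phys.
**96**, 223–250 (1984) [Balaban1984PropagatorsII].

CITATION HEADER (lean-in-tree rule 2026-08-18).  Cell `pub-balaban`, unit `b2b-balaban-b06-g12` (paper sub-cell B06,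
gen 12 — the owner lineage of `…B6Ineq268` (gen 5), `…B6DomainMajorant[Sandwich[Profile]]`, `…B6Prop23Chain`,
`…B6Prop23Assembled`, `…B6Prop23DomainInput`).  Imports: Mathlib + `…B6Prop23DomainInput` (p184827); nothing landed is
modified.  Source: doi:10.1007/bf01240221, held `paper:balaban1984-cmp96-propagators-rt-ii`; journal page = PDF page +
222; pp. 234–235 [PDF 12–13] read from the renders `b2b-balaban-ref1/pages/1984-cmp96-propagators-rt-II/1984-cmp96-
propagators-rt-II-p012-x2.png`, `…-p013-x2.png` AS IMAGES (the OCR of the displays is unusable).  Cell rows GAPS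
C-b06g12-8, DIVERGENCE D-b06.29; journal claim PROP23-KERNEL-INPUT.

THE PRINTED TEXT.  p. 234, Proposition 2.2, (2.67), first member, verbatim: *"|(G′λ)(x)| ≤ O(1)(L^jη)² e^{−½δ₀d(y,y′)}
|λ|, x ∈ B^j(y) …, y ∈ Λ_j, supp λ ⊂ B^{j′}(y′), y′ ∈ Λ_{j′}. (2.67)"* — typed (as everywhere in the lineage) as the
block majorant `HasMajorant blk G′ (fun a b => B₁·(len a)²·e^{−δ d(a,b)})`, δ = ½δ₀, B₁ = O(1).  p. 235 [PDF 13],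
verbatim: *"Let us consider now the operator Q′G′²Q′* and its inverse (Q′G′²Q′*)^{−1}. The inequalities (2.67) imply
|(Q′G′²Q′*)(y, y′)| = |Σ_{y″∈𝔅} (Q′G′Δ(y″)G′Q′*)(y, y′)| ≤ Σ_{y″∈𝔅} O(1)(L^jη)² e^{−½δ₀d(y,y″)} (L^{j″}η)² (L^{j′}η)^{−d}
e^{−½δ₀d(y″,y′)} ≤ O(1)(L^jη)⁴(L^{j′}η)^{−d} Σ_{y″∈𝔅} e^{−⅙δ₀d(y,y″)} L^{2(j″−j)} e^{−⅓δ₀d(y,y″)} e^{−⅓δ₀d(y″,y′)} ≤ …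
≤ O(1)(L^jη)⁴(L^{j′}η)^{−d} e^{−¼δ₀d(y,y′)}, (2.68) where we have used the inequalities (2.60), (2.63) of Lemma 1."*
(members 3–6 and the scale sum are certified in `…B6Ineq268`, gen 5: `line2_le_line5` — uniformly in the number of
scales iff 8 log L ≤ δ₀RM, GAPS G-adv9-37 / C-b06g5-2).  The kernel (Q′G′²Q′*)(y, y′) is the kernel in the pairing
(2.69) ⟨λ, λ′⟩ = Σ (L^jη)^d λ(y)λ′(y), i.e. the `X` of `kerOp (len^d) X = Q′∘(G′G′)∘Q′*` (`B6Prop23DomainInput`), and the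
printed (L^{j′}η)^{−d} is the weight moved to the left: |(L^{j′}η)^d X(y, y′)| ≤ O(1)(L^jη)⁴e^{−¼δ₀d(y,y′)} — the
hypothesis `hX` of `B6Prop23Assembled.prop23_assembled` (whose rate name δ₀ is ½δ₀ of the print here).

WHAT THIS MODULE PROVES (kernel-checked; no `sorry`, no axiom beyond Lean's three; bookkeeping only):
1. `conv_majorant_eq` — member 2 of (2.68) IS B₁²(L^jη)⁴·`B6Ineq268.line2 g (2δ)`: Σ_{y″} B₁(L^jη)²e^{−δd(y,y″)}·
   B₁(L^{j″}η)²e^{−δd(y″,y′)} = B₁²(L^jη)⁴ Σ_{y″} L^{2(j″−j)} e^{−½(2δ)d(y,y″)} e^{−½(2δ)d(y″,y′)} (`len_sq_eq`).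
2. `ineq261With_of_profile` — the (2.61)-type input of `line2_le_line5` at (δ₀, α) = (2δ, ¼) from the abstract profile
   of the lineage: `Profile g.dist id K` ⟹ `Ineq261With (K (δ/2)) g (2δ) ¼`.
3. `sq_majorant` — (2.67)₁ for T ⟹ T·T ≺ B₁²L²K(δ/2)·(L^jη)⁴e^{−½δd} (members 1–6 of (2.68) for the fine-lattice
   operator: `hasMajorant_mul` + item 1 + `line2_le_line5` under (2.54), symmetry, `LevelSep` (= the metric content of
   (2.60)), L ≥ 1, RM ≥ 0, the threshold L² ≤ e^{½δRM}).
4. `kernel_bound_of_majorant` — **(2.67)₁ ⇒ (2.68) in the pairing (2.69)**: with Q′ ≺ c_Q1, Q′* ≺ c_{Q*}1 and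
   `kerOp (len^d) X = Q′∘(T·T)∘Q′*`: |(L^{j″}η)^d X(y,y″)| ≤ c_Qc_{Q*}B₁²L²K(δ/2)·(L^jη)⁴·e^{−½δd(y,y″)}
   (`q_sandwich_majorant`, `hasMajorant_id_iff`, `mat_kerOp`); `kernel_bound_of_majorant_rate` — the same at any weaker
   rate δ_A ≤ δ (the form of `hX`/`hXw` at the assembled rate).
5. `prop23_assembled_rw` — **PROPOSITION 2.3 FROM THE RANDOM-WALK MAJORANTS**: `B6Prop23DomainInput.prop23_assembled_fine`
   with `hX`, `hXw` DISCHARGED by item 4 (B_X := c_Qc_{Q*}B₁²L²K(δ/2), the threshold for item 3 derived from the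
   assembled one `hthr`), i.e. `B6Prop23Assembled.prop23_assembled` with ALL THREE kernel inputs (2.68)/(2.68)(□̃)/change
   of domain derived from: the (2.67)₁-type block majorants of G′ and of every G′(□̃_i), the cut algebra of the □̃_i,
   the zone majorants of the commutator products, the Q′-data, the C_□ data (2.81)/(2.70), the partition data (2.36)
   etc., (2.60), the (2.61) profile, `Ineq261With`/`Ineq263With` for the expansion, the thresholds and the depth `hM₀`.
6. `kernel_bound_pt` — non-vacuity of item 4 on the one-point model.
WHAT IT DOES NOT PROVE: Proposition 2.2 / (2.67) itself (the random walk (2.50); hypothesis `hG`, `hGw`), Lemma 2.1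
((2.60)/(2.61): hypotheses), the cut algebra and commutator majorants of □̃ (hypotheses), (2.81) (hypothesis `h281`,
= Sect. B before (2.81), not this module), M₀ ≍ M (hypothesis `hM₀`).  Value = Prop. 2.3 assembled with two more located
hypotheses derived — bookkeeping, NOT summit progress.
-/

namespace Literature.MathematicalPhysics.QuantumFieldTheory.Balaban1983to89.B6Prop23KernelInput

open Finset Real
open B4Sect5Torus (IsPseudoDist)
open B6DomainChange (Profile)
open B6RandomWalk (HasMajorant hasMajorant_mul hasMajorant_mono)
open B6RandomWalkHom (HasMajorantHom)
open B6DomainMajorant (Ctot Ctot_nonneg)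
open B6DomainMajorantSandwich (q_sandwich_majorant)
open B6Expansion282 (kerOp kerOp_apply locOp Cglued R282)
open B6Prop23Chain (mat mat_kerOp hasMajorant_id_iff)
open B6Lemma21Repaired (Ineq261With Ineq263With)
open B6Ineq268 (line2 line5 ratio LevelSep Symm line2_le_line5 len_sq_eq ratio_nonneg)
open B6Prop23Assembled (K285)
open B6Prop23DomainInput (prop23_assembled_fine)

/-! ## §1  Member 2 of (2.68) is B₁²(L^jη)⁴ · line 2; the (2.61)-input from the profile -/

section ScaleSum

variable {g : B6.Geometry}

/-- **Member 2 of (2.68) = B₁²(L^jη)⁴ · `line2` at δ₀ = 2δ**: the convolution of two (2.67)₁ majorants,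
Σ_{y″} B₁(L^jη)²e^{−δd(y,y″)} · B₁(L^{j″}η)²e^{−δd(y″,y′)} = B₁²(L^jη)⁴ Σ_{y″} L^{2(j″−j)} e^{−½(2δ)d(y,y″)}
e^{−½(2δ)d(y″,y′)} ((L^{j″}η)² = (L^jη)²L^{2(j″−j)}, `B6Ineq268.len_sq_eq`). [cite: Balaban1984PropagatorsII, (2.68) p.235] -/
theorem conv_majorant_eq (hL : g.L ≠ 0) (hη : g.eta ≠ 0) (B₁ δ : ℝ) (y y' : g.Site) :
    ∑ y'' : g.Site, (B₁ * g.len y ^ 2 * Real.exp (-(δ * g.dist y y''))) *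
        (B₁ * g.len y'' ^ 2 * Real.exp (-(δ * g.dist y'' y'))) =
      B₁ ^ 2 * g.len y ^ 4 * line2 g (2 * δ) y y' := by
  unfold line2
  rw [Finset.mul_sum]
  refine Finset.sum_congr rfl fun y'' _ => ?_
  have h2 : (1 : ℝ) / 2 * (2 * δ) = δ := by ring
  rw [len_sq_eq hL hη y y'', h2]
  ring

/-- The (2.61)-type input of `B6Ineq268.line2_le_line5` at (δ₀, α) = (2δ, ¼), i.e. Σ_{y′} e^{−½δ·d(y,y′)} ≤ c, from the
abstract (2.61) profile of the lineage (`B6DomainChange.Profile`) read at the rate δ/2: c = K(δ/2).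
[cite: Balaban1984PropagatorsII, (2.61) p.234] -/
theorem ineq261With_of_profile {K : ℝ → ℝ} (hPr : Profile g.dist (fun a : g.Site => a) K) {δ : ℝ} (hδ : 0 < δ) :
    Ineq261With (K (δ / 2)) g (2 * δ) (1 / 4) := by
  intro y
  have h := hPr (δ / 2) (by positivity) y
  have hre : ∀ y' : g.Site, Real.exp (-(1 / 4 * (2 * δ) * g.dist y y')) = Real.exp (-(δ / 2 * g.dist y y')) :=
    fun y' => by congr 1; ring
  simp_rw [hre]
  exact h

end ScaleSum

/-! ## §2  (2.67)₁ ⇒ (2.68): the square of a (2.67)₁-majorised operator, and the kernel in the pairing (2.69) -/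

section KernelBound

variable {g : B6.Geometry} [DecidableEq g.Site] {X : Type}

omit [DecidableEq g.Site] in
/-- **Members 1–6 of (2.68) for the fine-lattice operator**: if T ≺ B₁(L^jη)²e^{−δd} with B₁ ≥ 0 ((2.67)₁, Prop. 2.2)
then T·T ≺ B₁²L²K(δ/2)·(L^jη)⁴e^{−½δd} — the product rule for majorants (*"A summation preserves it also"*, (2.52) ⇒
(2.55), `hasMajorant_mul`), member 2 = B₁²(L^jη)⁴·line 2 (`conv_majorant_eq`) and the certified scale sum line 2 ≤
L²c·line 5 of `…B6Ineq268` (`line2_le_line5`: (2.54), symmetry, `LevelSep` = the metric content of (2.60), L ≥ 1,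
RM ≥ 0, (2.61) at rate ½δ from the profile, and the threshold L² ≤ e^{¼(2δ)RM}).
[cite: Balaban1984PropagatorsII, (2.67)–(2.68) pp.234–235] -/
theorem sq_majorant (blk : X → g.Site) (hρ : IsPseudoDist g.dist) (hsep : LevelSep g) (hL : 1 ≤ g.L)
    (hη : 0 < g.eta) (hRM : 0 ≤ g.R * g.M) {K : ℝ → ℝ} (hPr : Profile g.dist (fun a : g.Site => a) K)
    {δ B₁ : ℝ} (hδ : 0 < δ) (hB₁ : 0 ≤ B₁) (hthr : g.L ^ 2 ≤ Real.exp (1 / 4 * (2 * δ) * g.R * g.M))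
    {T : Module.End ℝ (X → ℝ)}
    (hT : HasMajorant blk T (fun a b => B₁ * g.len a ^ 2 * Real.exp (-(δ * g.dist a b)))) :
    HasMajorant blk (T * T)
      (fun a b => B₁ ^ 2 * (g.L ^ 2 * K (δ / 2)) * g.len a ^ 4 * Real.exp (-(1 / 2 * δ * g.dist a b))) := by
  have hL0 : g.L ≠ 0 := ne_of_gt (lt_of_lt_of_le zero_lt_one hL)
  have hη0 : g.eta ≠ 0 := ne_of_gt hη
  have hK₂ : ∀ a b : g.Site, 0 ≤ B₁ * g.len a ^ 2 * Real.exp (-(δ * g.dist a b)) := fun a b => by positivity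
  refine hasMajorant_mono blk (hasMajorant_mul blk hT hT hK₂) fun a b => ?_
  show ∑ y'' : g.Site, (B₁ * g.len a ^ 2 * Real.exp (-(δ * g.dist a y''))) *
      (B₁ * g.len y'' ^ 2 * Real.exp (-(δ * g.dist y'' b))) ≤ _
  rw [conv_majorant_eq hL0 hη0 B₁ δ a b]
  have h25 := line2_le_line5 hρ.triangle hρ.symm hsep hL hRM (δ₀ := 2 * δ) (by linarith)
    (ineq261With_of_profile hPr hδ) hthr a b
  have h5 : line5 g (2 * δ) a b = Real.exp (-(1 / 2 * δ * g.dist a b)) := by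
    unfold line5; congr 1; ring
  have hpre : 0 ≤ B₁ ^ 2 * g.len a ^ 4 := by positivity
  calc B₁ ^ 2 * g.len a ^ 4 * line2 g (2 * δ) a b
      ≤ B₁ ^ 2 * g.len a ^ 4 * (g.L ^ 2 * K (δ / 2) * line5 g (2 * δ) a b) := mul_le_mul_of_nonneg_left h25 hpre
    _ = _ := by rw [h5]; ring

/-- **(2.67)₁ ⇒ (2.68) IN THE PAIRING (2.69)** (p. 235: *"The inequalities (2.67) imply |(Q′G′²Q′*)(y, y′)| … ≤
O(1)(L^jη)⁴(L^{j′}η)^{−d} e^{−¼δ₀d(y,y′)}, (2.68)"*): with T ≺ B₁(L^jη)²e^{−δd} (B₁ ≥ 0), Q′ ≺ c_Q1, Q′* ≺ c_{Q*}1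
(c_{Q*} ≥ 0) and the (2.69)-kernel X of Q′T²Q′* (`kerOp (len^d) X = Q′∘(T·T)∘Q′*`), under the inputs of `sq_majorant`:
`|(L^{j″}η)^d X(y,y″)| ≤ c_Qc_{Q*}B₁²L²K(δ/2)·(L^jη)⁴·e^{−½δd(y,y″)}` — the printed (L^{j′}η)^{−d} moved to the left,
O(1) = c_Qc_{Q*}B₁²L²K(δ/2), ¼δ₀ = ½δ. [cite: Balaban1984PropagatorsII, (2.68) p.235] -/
theorem kernel_bound_of_majorant (blk : X → g.Site) (hρ : IsPseudoDist g.dist) (hsep : LevelSep g) (hL : 1 ≤ g.L)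
    (hη : 0 < g.eta) (hRM : 0 ≤ g.R * g.M) {K : ℝ → ℝ} (hK : ∀ a, 0 < a → 0 ≤ K a)
    (hPr : Profile g.dist (fun a : g.Site => a) K)
    {δ B₁ : ℝ} (hδ : 0 < δ) (hB₁ : 0 ≤ B₁) (hthr : g.L ^ 2 ≤ Real.exp (1 / 4 * (2 * δ) * g.R * g.M))
    {T : Module.End ℝ (X → ℝ)}
    (hT : HasMajorant blk T (fun a b => B₁ * g.len a ^ 2 * Real.exp (-(δ * g.dist a b))))
    {Qp : (X → ℝ) →ₗ[ℝ] (g.Site → ℝ)} {Qs : (g.Site → ℝ) →ₗ[ℝ] (X → ℝ)} {cQ cQs : ℝ} (hcQs : 0 ≤ cQs)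
    (hQ : HasMajorantHom blk (fun y : g.Site => y) Qp (fun (a b : g.Site) => cQ * (if a = b then (1 : ℝ) else 0)))
    (hQs : HasMajorantHom (fun y : g.Site => y) blk Qs (fun (a b : g.Site) => cQs * (if a = b then (1 : ℝ) else 0)))
    (d : ℕ) {Xk : g.Site → g.Site → ℝ} (hX : kerOp (fun z => g.len z ^ d) Xk = Qp ∘ₗ (T * T) ∘ₗ Qs)
    (y y'' : g.Site) :
    |g.len y'' ^ d * Xk y y''| ≤
      cQ * cQs * (B₁ ^ 2 * (g.L ^ 2 * K (δ / 2))) * g.len y ^ 4 * Real.exp (-(1 / 2 * δ * g.dist y y'')) := by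
  have hsq := sq_majorant blk hρ hsep hL hη hRM hPr hδ hB₁ hthr hT
  have hKnn : ∀ a b : g.Site,
      0 ≤ B₁ ^ 2 * (g.L ^ 2 * K (δ / 2)) * g.len a ^ 4 * Real.exp (-(1 / 2 * δ * g.dist a b)) := by
    intro a b; have := hK (δ / 2) (by positivity); positivity
  have hsand := q_sandwich_majorant blk cQ cQs hcQs hKnn hQ hQs hsq
  have hmat : |mat (Qp ∘ₗ (T * T) ∘ₗ Qs) y y''| ≤
      cQ * cQs * (B₁ ^ 2 * (g.L ^ 2 * K (δ / 2)) * g.len y ^ 4 * Real.exp (-(1 / 2 * δ * g.dist y y''))) :=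
    (hasMajorant_id_iff _ _).mp hsand y y''
  have hker : g.len y'' ^ d * Xk y y'' = mat (Qp ∘ₗ (T * T) ∘ₗ Qs) y y'' := by rw [← hX, mat_kerOp]
  rw [hker]
  exact hmat.trans_eq (by ring)

/-- The same at any weaker rate δ_A ≤ δ (d ≥ 0 by (2.54)): the form of `hX` / `hXw` of `prop23_assembled` at the
assembled rate. [folklore] -/
theorem kernel_bound_of_majorant_rate (blk : X → g.Site) (hρ : IsPseudoDist g.dist) (hsep : LevelSep g)
    (hL : 1 ≤ g.L) (hη : 0 < g.eta) (hRM : 0 ≤ g.R * g.M) {K : ℝ → ℝ} (hK : ∀ a, 0 < a → 0 ≤ K a)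
    (hPr : Profile g.dist (fun a : g.Site => a) K)
    {δ B₁ : ℝ} (hδ : 0 < δ) (hB₁ : 0 ≤ B₁) (hthr : g.L ^ 2 ≤ Real.exp (1 / 4 * (2 * δ) * g.R * g.M))
    {T : Module.End ℝ (X → ℝ)}
    (hT : HasMajorant blk T (fun a b => B₁ * g.len a ^ 2 * Real.exp (-(δ * g.dist a b))))
    {Qp : (X → ℝ) →ₗ[ℝ] (g.Site → ℝ)} {Qs : (g.Site → ℝ) →ₗ[ℝ] (X → ℝ)} {cQ cQs : ℝ} (hcQ : 0 ≤ cQ)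
    (hcQs : 0 ≤ cQs)
    (hQ : HasMajorantHom blk (fun y : g.Site => y) Qp (fun (a b : g.Site) => cQ * (if a = b then (1 : ℝ) else 0)))
    (hQs : HasMajorantHom (fun y : g.Site => y) blk Qs (fun (a b : g.Site) => cQs * (if a = b then (1 : ℝ) else 0)))
    (d : ℕ) {Xk : g.Site → g.Site → ℝ} (hX : kerOp (fun z => g.len z ^ d) Xk = Qp ∘ₗ (T * T) ∘ₗ Qs)
    {δA : ℝ} (hδA : δA ≤ δ) (y y'' : g.Site) :
    |g.len y'' ^ d * Xk y y''| ≤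
      cQ * cQs * (B₁ ^ 2 * (g.L ^ 2 * K (δ / 2))) * g.len y ^ 4 * Real.exp (-(1 / 2 * δA * g.dist y y'')) := by
  refine (kernel_bound_of_majorant blk hρ hsep hL hη hRM hK hPr hδ hB₁ hthr hT hcQs hQ hQs d hX y y'').trans ?_
  have hpre : 0 ≤ cQ * cQs * (B₁ ^ 2 * (g.L ^ 2 * K (δ / 2))) * g.len y ^ 4 := by
    have := hK (δ / 2) (by positivity); positivity
  refine mul_le_mul_of_nonneg_left (Real.exp_le_exp.mpr ?_) hpre
  have hd := hρ.nonneg y y''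
  nlinarith

end KernelBound

/-! ## §3  Proposition 2.3 re-assembled from the random-walk majorants -/

section Reassembly

variable {g : B6.Geometry} [DecidableEq g.Site] {X : Type} {ι : Type} [Fintype ι] [DecidableEq ι]

/-- **PROPOSITION 2.3 FROM THE RANDOM-WALK MAJORANTS** (p. 235 (2.67) ⇒ (2.68) + p. 238 before (2.85) ⇒ (2.85) ⇒
Lemma 2.1 ⇒ (2.86)–(2.87)): `B6Prop23DomainInput.prop23_assembled_fine` with ITS kernel inputs `hX`, `hXw` ((2.68)
for Q′G′²Q′* and for every Q′G′(□̃_i)²Q′*) DISCHARGED by `kernel_bound_of_majorant_rate` from the (2.67)₁-type block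
majorants `hG`, `hGw i` — B_X := c_Qc_{Q*}B₁²L²K(δ/2), the threshold for the scale sum of (2.68) (L² ≤ e^{½δRM})
derived from the assembled one `hthr` (L ≥ 1, (δ − α′δ₀)/3 ≤ δ).  So `B6Prop23Assembled.prop23_assembled` now holds
with all three kernel inputs ((2.68), (2.68) for □̃, the change of domain) DERIVED; what stays located: the block
majorants of G′, G′(□̃_i) ((2.67)₁, Prop. 2.2), the cut algebra and commutator zone majorants of the □̃_i, the Q′-data,
the C_□ data (2.81)/(2.70), the partition data, (2.60), the (2.61) profile, `Ineq261With`/`Ineq263With`, the thresholds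
`hthr`/`hKM` and the depth comparison `hM₀`.  Conclusion verbatim that of `prop23_assembled` (inverse of Q′G′²Q′* in
the pairing (2.69), (2.86), uniqueness, (2.87)). [cite: Balaban1984PropagatorsII, Proposition 2.3 (2.85)–(2.87) p.238] -/
theorem prop23_assembled_rw (d : ℕ) (hρ : IsPseudoDist g.dist) (hsep : LevelSep g) (hL : 1 ≤ g.L)
    (hη : 0 < g.eta) (hM : 0 < g.M) (hRM : 0 ≤ g.R * g.M)
    -- the fine-lattice side: blocks, (2.60), the (2.61) profile, the located size condition
    (blk : X → g.Site) {δ₀ α' : ℝ} (h260 : B6RandomWalk.Ineq260 g δ₀ α') {K : ℝ → ℝ}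
    (hK : ∀ a, 0 < a → 0 ≤ K a) (hPr : Profile g.dist (fun a : g.Site => a) K) (hα' : 0 ≤ α' * δ₀)
    (hsize : g.L ^ 2 * Real.exp (-(α' * δ₀ * (g.R * g.M))) ≤ 1)
    {δ B₁ θ : ℝ} (hκδ : α' * δ₀ < δ) (hB₁ : 0 ≤ B₁) (hθ : 0 ≤ θ)
    -- the constants of the assembled Prop. 2.3 (its δ₀ is (δ − α′δ₀)/3 here)
    {δ₁ σ cσ c c₃ s mg BC : ℝ} (hδ₁ : 0 ≤ δ₁) (hsplit : δ₁ + σ * ((δ - α' * δ₀) / 3) ≤ (δ - α' * δ₀) / 3 / 4)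
    (h261σ : Ineq261With cσ g ((δ - α' * δ₀) / 3) σ)
    (hthr : g.L ^ 4 ≤ Real.exp (1 / 8 * ((δ - α' * δ₀) / 3) * g.R * g.M))
    (h261 : Ineq261With c g δ₁ (1 / 2)) (h263 : Ineq263With c g δ₁ (1 / 2)) (hc : 0 ≤ c)
    (hc₃ : 0 < c₃) (hs : 0 ≤ s) (hmg : 0 < mg) (hBC : 0 ≤ BC)
    -- the cubes □_i = pf i, the partition of unity h_i = hf i, the kernels X, X̃_i, C_i in the pairing (2.69)
    {pf hf : ι → g.Site → ℝ} {js : ι → ℕ} {n₀ : ℕ} {Xk : g.Site → g.Site → ℝ}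
    {Xwk Ck : ι → g.Site → g.Site → ℝ}
    (hover : ∀ y, (Finset.univ.filter fun i => hf i y ≠ 0).card ≤ n₀)
    (hpf01 : ∀ i y, pf i y = 0 ∨ pf i y = 1) (hph : ∀ i y, pf i y * hf i y = hf i y)
    (h236 : ∀ y, ∑ i, hf i y ^ 2 = 1) (hLip : ∀ i y y'', |hf i y - hf i y''| ≤ s / g.M * g.dist y y'')
    (hcube : ∀ i y, pf i y ≠ 0 → js i ≤ g.scale y ∧ g.scale y ≤ js i + 1)
    (hlev : ∀ i y y', hf i y ≠ 0 → hf i y' ≠ 0 → g.scale y = g.scale y')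
    (hgap : ∀ i y y'', pf i y = 0 → hf i y'' ≠ 0 → mg * g.M ≤ g.dist y y'')
    (h281 : ∀ i y y', pf i y ≠ 0 → pf i y' ≠ 0 →
      |Ck i y y'| ≤ BC / (g.L ^ js i * g.eta) ^ (d + 4) * Real.exp (-(δ₁ * g.dist y y')))
    (hCk0 : ∀ i y'' y', pf i y'' = 0 → Ck i y'' y' = 0)
    (h270 : ∀ i, locOp (fun i => B6Expansion282.mulOp (pf i)) (fun i => kerOp (fun z => g.len z ^ d) (Xwk i)) i *
      kerOp (fun z => g.len z ^ d) (Ck i) * B6Expansion282.mulOp (hf i) = B6Expansion282.mulOp (hf i))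
    -- the fine-lattice data of each cube: zone N_i, cut-off χ_i, D_i, G′(□̃_i) = Gw i; G′ = G, Q′ = Qp, Q′* = Qs
    (N : ι → Finset g.Site) (hN : ∀ i, (N i).Nonempty)
    {G : Module.End ℝ (X → ℝ)} {Dop Gw : ι → Module.End ℝ (X → ℝ)} {χ : ι → X → ℝ}
    (hχ1 : ∀ i x, |χ i x| ≤ 1)
    (hpfχ : ∀ i x, pf i (blk x) * χ i x = pf i (blk x)) (hhχ : ∀ i x, χ i x * hf i (blk x) = hf i (blk x))
    (hχN : ∀ i x, blk x ∉ N i → χ i x = 1)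
    (hGD : ∀ i, G * Dop i = 1) (hDG : ∀ i, Dop i * G = 1)
    (hχGw : ∀ i, B9Thm37Sum.mulOp (χ i) * Dop i * Gw i = B9Thm37Sum.mulOp (χ i))
    (hGwχ : ∀ i, Gw i * Dop i * B9Thm37Sum.mulOp (χ i) = B9Thm37Sum.mulOp (χ i))
    (hG : HasMajorant blk G (fun a b => B₁ * g.len a ^ 2 * Real.exp (-(δ * g.dist a b))))
    (hGw : ∀ i, HasMajorant blk (Gw i) (fun a b => B₁ * g.len a ^ 2 * Real.exp (-(δ * g.dist a b))))
    (hKGw : ∀ i, HasMajorant blk ((B9Thm37Sum.mulOp (χ i) * Dop i - Dop i * B9Thm37Sum.mulOp (χ i)) * Gw i)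
      (fun a b => (if a ∈ N i then θ else 0) * Real.exp (-(δ * g.dist a b))))
    (hKG : ∀ i, HasMajorant blk ((B9Thm37Sum.mulOp (χ i) * Dop i - Dop i * B9Thm37Sum.mulOp (χ i)) * G)
      (fun a b => (if a ∈ N i then θ else 0) * Real.exp (-(δ * g.dist a b))))
    {M₀ : ℝ} (hpfdeep : ∀ i y, pf i y ≠ 0 → ∀ n ∈ N i, M₀ ≤ g.dist y n)
    (hhdeep : ∀ i y, hf i y ≠ 0 → ∀ n ∈ N i, M₀ ≤ g.dist y n)
    {Qp : (X → ℝ) →ₗ[ℝ] (g.Site → ℝ)} {Qs : (g.Site → ℝ) →ₗ[ℝ] (X → ℝ)} {cQ cQs : ℝ} (hcQ : 0 ≤ cQ)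
    (hcQs : 0 ≤ cQs)
    (hQ : HasMajorantHom blk (fun y : g.Site => y) Qp (fun (a b : g.Site) => cQ * (if a = b then (1 : ℝ) else 0)))
    (hQs : HasMajorantHom (fun y : g.Site => y) blk Qs (fun (a b : g.Site) => cQs * (if a = b then (1 : ℝ) else 0)))
    (hQχ : ∀ i, (B9Thm37Sum.mulOp (pf i) : Module.End ℝ (g.Site → ℝ)) ∘ₗ Qp =
      Qp ∘ₗ (B9Thm37Sum.mulOp (pf i ∘ blk) : Module.End ℝ (X → ℝ)))
    (hQsh : ∀ i, Qs ∘ₗ (B9Thm37Sum.mulOp (hf i) : Module.End ℝ (g.Site → ℝ)) =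
      (B9Thm37Sum.mulOp (hf i ∘ blk) : Module.End ℝ (X → ℝ)) ∘ₗ Qs)
    -- the dictionary (definitions of X, X̃_i as the (2.69)-kernels of Q′G′²Q′*, Q′G′(□̃_i)²Q′*) and the depth
    (hXdef : kerOp (fun z => g.len z ^ d) Xk = Qp ∘ₗ (G * G) ∘ₗ Qs)
    (hXwdef : ∀ i, kerOp (fun z => g.len z ^ d) (Xwk i) = Qp ∘ₗ (Gw i * Gw i) ∘ₗ Qs)
    (hM₀ : c₃ * g.M ≤ (δ - α' * δ₀) / 3 * M₀)
    -- «M large enough», with B_X := c_Q c_{Q*} B₁² L² K(δ/2) and B_D := c_Q c_{Q*} L² C_tot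
    (hKM : 2 * K285 g d n₀ s ((δ - α' * δ₀) / 3) cσ c₃ mg (cQ * cQs * (B₁ ^ 2 * (g.L ^ 2 * K (δ / 2))))
      (cQ * cQs * (g.L ^ 2 * Ctot K B₁ θ (δ - α' * δ₀))) BC * c ≤ g.M) :
    ∃ Ginv : Module.End ℝ (g.Site → ℝ),
      Ginv * kerOp (fun z => g.len z ^ d) Xk = 1 ∧ kerOp (fun z => g.len z ^ d) Xk * Ginv = 1 ∧
      Ginv = Cglued (fun i => B6Expansion282.mulOp (hf i)) (fun i => kerOp (fun z => g.len z ^ d) (Ck i)) +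
        Ginv * R282 (kerOp (fun z => g.len z ^ d) Xk) (fun i => B6Expansion282.mulOp (pf i))
          (fun i => kerOp (fun z => g.len z ^ d) (Xwk i)) (fun i => B6Expansion282.mulOp (hf i))
          (fun i => kerOp (fun z => g.len z ^ d) (Ck i)) ∧
      (∀ G' : Module.End ℝ (g.Site → ℝ), G' * kerOp (fun z => g.len z ^ d) Xk = 1 → G' = Ginv) ∧
      ∀ y y', |mat Ginv y y' / g.len y' ^ d| ≤
        2 * (n₀ * (BC * g.L ^ (d + 4))) * c * g.len y ^ (-(4 : ℝ)) * g.len y' ^ (-(d : ℝ)) *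
          Real.exp (-(δ₁ / 2 * g.dist y y')) := by
  have hδ : 0 < δ := lt_of_le_of_lt hα' hκδ
  have hδA : (δ - α' * δ₀) / 3 ≤ δ := by linarith
  have hL2 : g.L ^ 2 ≤ g.L ^ 4 := pow_le_pow_right₀ hL (by norm_num)
  have hexp : Real.exp (1 / 8 * ((δ - α' * δ₀) / 3) * g.R * g.M) ≤ Real.exp (1 / 4 * (2 * δ) * g.R * g.M) := by
    refine Real.exp_le_exp.mpr ?_
    have h1 : 1 / 8 * ((δ - α' * δ₀) / 3) ≤ 1 / 4 * (2 * δ) := by linarith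
    calc 1 / 8 * ((δ - α' * δ₀) / 3) * g.R * g.M = 1 / 8 * ((δ - α' * δ₀) / 3) * (g.R * g.M) := by ring
      _ ≤ 1 / 4 * (2 * δ) * (g.R * g.M) := mul_le_mul_of_nonneg_right h1 hRM
      _ = _ := by ring
  have hthr2 : g.L ^ 2 ≤ Real.exp (1 / 4 * (2 * δ) * g.R * g.M) := hL2.trans (hthr.trans hexp)
  have hBX : 0 ≤ cQ * cQs * (B₁ ^ 2 * (g.L ^ 2 * K (δ / 2))) := by
    have := hK (δ / 2) (by positivity); positivity
  exact prop23_assembled_fine d hρ hsep hL hη hM hRM blk h260 hK hPr hα' hsize hκδ hB₁ hθ hδ₁ hsplit h261σ hthr h261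
    h263 hc hc₃ hs hmg hBX hBC hover hpf01 hph h236 hLip hcube hlev hgap
    (fun y y'' => kernel_bound_of_majorant_rate blk hρ hsep hL hη hRM hK hPr hδ hB₁ hthr2 hG hcQ hcQs hQ hQs d hXdef
      hδA y y'')
    (fun i y y'' => kernel_bound_of_majorant_rate blk hρ hsep hL hη hRM hK hPr hδ hB₁ hthr2 (hGw i) hcQ hcQs hQ hQs d
      (hXwdef i) hδA y y'')
    h281 hCk0 h270 N hN hχ1 hpfχ hhχ hχN hGD hDG hχGw hGwχ hG hGw hKGw hKG hpfdeep hhdeep hcQ hcQs hQ hQs hQχ hQsh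
    hXdef hXwdef hM₀ hKM

end Reassembly

/-! ## §4  Consistency of the kernel-bound's hypothesis package: the one-point model -/

section NonVacuity

open B6Prop23Assembled (ptGeo ptGeo_len ptGeo_dist)

/-- **NON-VACUITY OF `kernel_bound_of_majorant`**: all its hypotheses hold simultaneously on the one-point model
(fine lattice = 𝔅 = {pt} = `B6Prop23Assembled.ptGeo`, blocks = id, T = 1, Q′ = Q′* = id, K = B₁ = c_Q = c_{Q*} = δ = 1,
X = the unit kernel); the term below is the theorem applied there with every hypothesis discharged. [folklore] -/
theorem kernel_bound_pt (d : ℕ) (y y'' : ptGeo.Site) :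
    |ptGeo.len y'' ^ d * (1 : ℝ)| ≤
      1 * 1 * ((1 : ℝ) ^ 2 * (ptGeo.L ^ 2 * 1)) * ptGeo.len y ^ 4 * Real.exp (-(1 / 2 * 1 * ptGeo.dist y y'')) := by
  classical
  have hK1 : kerOp (fun z => ptGeo.len z ^ d) (fun _ _ : ptGeo.Site => (1 : ℝ)) =
      LinearMap.id ∘ₗ ((1 : Module.End ℝ (ptGeo.Site → ℝ)) * 1) ∘ₗ LinearMap.id := by
    refine LinearMap.ext fun μ => funext fun u => ?_
    cases u
    simp [kerOp_apply]
  have hmaj1 : HasMajorant (fun u : ptGeo.Site => u) (1 : Module.End ℝ (ptGeo.Site → ℝ))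
      (fun a b => 1 * ptGeo.len a ^ 2 * Real.exp (-(1 * ptGeo.dist a b))) := by
    intro y' μ B hμ x
    cases x; cases y'
    have hb := hμ.bound PUnit.unit rfl
    simpa using hb
  have hQid : HasMajorantHom (fun u : ptGeo.Site => u) (fun u : ptGeo.Site => u)
      (LinearMap.id : (ptGeo.Site → ℝ) →ₗ[ℝ] (ptGeo.Site → ℝ))
      (fun (a b : ptGeo.Site) => 1 * (if a = b then (1 : ℝ) else 0)) := by
    intro y' μ B hμ v
    cases v; cases y'
    have hb := hμ.bound PUnit.unit rfl
    simpa using hb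
  exact kernel_bound_of_majorant (g := ptGeo) (X := ptGeo.Site) (fun u => u)
    ⟨fun _ _ => rfl, fun _ => rfl, fun _ _ _ => by simp⟩ (fun _ _ => by simp) (by simp) (by simp)
    (by simp) (K := fun _ => 1) (fun _ _ => zero_le_one) (fun a _ s => by simp) (δ := 1) (B₁ := 1) one_pos zero_le_one
    (by simp) (T := 1) hmaj1 (Qp := LinearMap.id) (Qs := LinearMap.id) (cQ := 1) (cQs := 1) zero_le_one hQid hQid d
    (Xk := fun _ _ => 1) hK1 y y''

end NonVacuity

end Literature.MathematicalPhysics.QuantumFieldTheory.Balaban1983to89.B6Prop23KernelInput
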